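import Mathlib

/-!
# The all-integer extremal family `M'(d)`: data and vertex lemmas (sharpness of the plateau length law, every odd reach)

Cell pub-symmetroid, seat conjb-2 (g22). A helper toward the crux `TropicalB`
(`Summit.ValiantsHypothesis.ValiantsHypothesis.Theses.KPlusLogSqLaw.TropicalB`, item
`stmt-ValiantsHypothesis-19771`); it earns no crux credit and is not evidence for `MatrixDescartes` or for
Valiant's hypothesis. Mathlib only.

Static path model as in the `KPlusLogSqLawStep*` files (lines `S_t(θ) = b t + s t * θ`, even index = upper class, window
`[j, j+d]` separated at `θ` iff every even-indexed line of it is strictly above every odd-indexed one, a row steps iff two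
consecutive windows have non-empty disjoint separation sets). THE PLATEAU LENGTH LAW (THEORY-NOTE-g22 §1, pencil): at odd
reach `d ≥ 3` at most `d + 2` consecutive rows step. THIS FILE and its sequel `KPlusLogSqLawStepSharpAll` prove that the
bound is attained for EVERY odd `d = 2n+1 ≥ 3` (THEORY-NOTE-g22 §1ter, family M'), by the explicit integer configuration:
points `X_r = (r, y_r)` (`0 ≤ r ≤ d`), the EDGE lines `ℓ_t` (`1 ≤ t ≤ d`) through `X_{t-1}, X_t`, `ℓ_0` through `X_0`, the
CHORD `ℓ_{d+1}` through `X_0` and `X_d`, the WHISKERS `ℓ_{d+1+r}` through `X_r` (`1 ≤ r ≤ d`) and `ℓ_{2d+2}` through `X_d`,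
with slopes (`u` = even index, `l` = odd): `u_{2i} = 2n+2-i` (`i ≤ n`), `l_{2i+1} = 2n+3+i` (`i ≤ n-1`), `l_d = (n+1)(2n+3)`,
`u_{d+1} = 3n+3`, lower whiskers `l_{d+2i} = i-1` (`1 ≤ i ≤ n`), `l_{2d+1} = 3n+2`, `u_{2d+2} = 3n+1`, upper whiskers
`u_{d+1+2r} = (n+1)(2n+3)+r` (`1 ≤ r ≤ n`); `y_{2a} = 4(n+1)a`, `y_{2a+1} = (4n+5)a+2n+3` (`a ≤ n-1`), `y_d = 3(n+1)(2n+1)`.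
Here: the data `sM, yM, vM, bM`, the vertex excess `EM n t j = S_t(j) - y_j` (an integer), its value lemmas, and the
VERTEX LEMMAS — at `X_j` every line `t ∈ [j, j+d+1]` lies weakly on its class's side (`EM ≥ 0` for even `t`, `≤ 0` for
odd `t`), with equality exactly for the lines through `X_j`; all signs are constant term by term (no dominance estimate).
-/

set_option linter.dupNamespace false

namespace Summit.ValiantsHypothesis.ValiantsHypothesis.Theorems.KPlusLogSqLawStepSharpFamily

/-- Slope of line `t` at reach `d = 2n+1` (family M'). -/
def sM (n t : ℕ) : ℤ :=
  if t ≤ 2 * n then (if Even t then (2 * n + 2 : ℤ) - (t / 2 : ℕ) else (2 * n + 3 : ℤ) + (t / 2 : ℕ))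
  else if t = 2 * n + 1 then (n + 1) * (2 * n + 3)
  else if t = 2 * n + 2 then 3 * n + 3
  else if t = 4 * n + 3 then 3 * n + 2
  else if t = 4 * n + 4 then 3 * n + 1
  else if Even t then (n + 1) * (2 * n + 3) + ((t - (2 * n + 2)) / 2 : ℕ)
  else (((t - (2 * n + 1)) / 2 : ℕ) : ℤ) - 1

/-- Ordinate of the vertex `X_r = (r, yM n r)`, `0 ≤ r ≤ d = 2n+1`. -/
def yM (n r : ℕ) : ℤ :=
  if r = 2 * n + 1 then 3 * (n + 1) * (2 * n + 1)
  else if Even r then 4 * (n + 1) * (r / 2 : ℕ) else (4 * n + 5) * (r / 2 : ℕ) + 2 * n + 3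

/-- The designated vertex through which line `t` passes. -/
def vM (n t : ℕ) : ℕ :=
  if t = 0 then 0 else if t ≤ 2 * n + 1 then t - 1 else if t = 2 * n + 2 then 0
  else if t = 4 * n + 4 then 2 * n + 1 else t - (2 * n + 2)

/-- Intercept of line `t`. -/
def bM (n t : ℕ) : ℤ := yM n (vM n t) - sM n t * (vM n t)

/-- Vertex excess: value of line `t` at abscissa `j` minus `y_j`. -/
def EM (n t j : ℕ) : ℤ := bM n t + sM n t * j - yM n j

/-! ## Value lemmas -/

/-- Slope of the upper edge / initial line `u_{2i}`: `2n+2-i`. -/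
theorem sM_u (n i : ℕ) (hi : i ≤ n) : sM n (2 * i) = 2 * n + 2 - i := by
  unfold sM
  rw [if_pos (by omega), if_pos ⟨i, by ring⟩]
  have : 2 * i / 2 = i := by omega
  simp [this]

/-- Slope of the lower edge `l_{2i+1}` (`2i+1 ≤ d-2`): `2n+3+i`. -/
theorem sM_l (n i : ℕ) (hi : i + 1 ≤ n) : sM n (2 * i + 1) = 2 * n + 3 + i := by
  unfold sM
  rw [if_pos (by omega), if_neg (by rw [Nat.even_add_one]; exact fun h => h ⟨i, by ring⟩)]
  have : (2 * i + 1) / 2 = i := by omega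
  simp [this]

/-- Slope of the last edge `l_d`: `(n+1)(2n+3)`. -/
theorem sM_last (n : ℕ) : sM n (2 * n + 1) = (n + 1) * (2 * n + 3) := by
  unfold sM; rw [if_neg (by omega), if_pos rfl]

/-- Slope of the chord `u_{d+1}`: `3n+3`. -/
theorem sM_chord (n : ℕ) : sM n (2 * n + 2) = 3 * n + 3 := by
  unfold sM; rw [if_neg (by omega), if_neg (by omega), if_pos rfl]

/-- Slope of the lower whisker `l_{2d+1}` at `X_d`: `3n+2`. -/
theorem sM_l2d1 (n : ℕ) : sM n (4 * n + 3) = 3 * n + 2 := by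
  unfold sM; rw [if_neg (by omega), if_neg (by omega), if_neg (by omega), if_pos rfl]

/-- Slope of the last line `u_{2d+2}` at `X_d`: `3n+1`. -/
theorem sM_u2d2 (n : ℕ) : sM n (4 * n + 4) = 3 * n + 1 := by
  unfold sM; rw [if_neg (by omega), if_neg (by omega), if_neg (by omega), if_neg (by omega), if_pos rfl]

/-- Slope of the upper whisker at `X_{2r}`: `(n+1)(2n+3)+r`. -/
theorem sM_uw (n r : ℕ) (hr : 1 ≤ r) (hr' : r ≤ n) :
    sM n (2 * n + 2 + 2 * r) = (n + 1) * (2 * n + 3) + r := by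
  unfold sM
  rw [if_neg (by omega), if_neg (by omega), if_neg (by omega), if_neg (by omega), if_neg (by omega),
    if_pos ⟨n + 1 + r, by ring⟩]
  have h : (2 * n + 2 + 2 * r - (2 * n + 2)) / 2 = r := by omega
  simp only [h]

/-- Slope of the lower whisker at `X_{2i-1}`: `i-1`. -/
theorem sM_lw (n i : ℕ) (hi : 1 ≤ i) (hi' : i ≤ n) : sM n (2 * n + 1 + 2 * i) = (i : ℤ) - 1 := by
  unfold sM
  have hne : ¬ Even (2 * n + 1 + 2 * i) := by
    rw [Nat.even_iff]; omega
  rw [if_neg (by omega), if_neg (by omega), if_neg (by omega), if_neg (by omega), if_neg (by omega), if_neg hne]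
  have h : (2 * n + 1 + 2 * i - (2 * n + 1)) / 2 = i := by omega
  simp only [h]

/-- Ordinate of an even vertex: `y_{2a} = 4(n+1)a`. -/
theorem yM_even (n a : ℕ) : yM n (2 * a) = 4 * (n + 1) * a := by
  unfold yM
  rw [if_neg (by omega), if_pos ⟨a, by ring⟩]
  have : 2 * a / 2 = a := by omega
  simp [this]

/-- Ordinate of an odd vertex before the last: `y_{2a+1} = (4n+5)a+2n+3`. -/
theorem yM_odd (n a : ℕ) (ha : a + 1 ≤ n) : yM n (2 * a + 1) = (4 * n + 5) * a + 2 * n + 3 := by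
  unfold yM
  rw [if_neg (by omega), if_neg (by rw [Nat.even_add_one]; exact fun h => h ⟨a, by ring⟩)]
  have : (2 * a + 1) / 2 = a := by omega
  simp [this]

/-- Ordinate of the last vertex: `y_d = 3(n+1)(2n+1)`. -/
theorem yM_last (n : ℕ) : yM n (2 * n + 1) = 3 * (n + 1) * (2 * n + 1) := by
  unfold yM; rw [if_pos rfl]

/-- `y_0 = 0`. -/
theorem yM_zero (n : ℕ) : yM n 0 = 0 := by simpa using yM_even n 0

/-- `ℓ_0` passes through `X_0`. -/
theorem vM_zero (n : ℕ) : vM n 0 = 0 := by unfold vM; simp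

/-- Edge `t` is anchored at `X_{t-1}`. -/
theorem vM_edge (n t : ℕ) (h1 : 1 ≤ t) (h2 : t ≤ 2 * n + 1) : vM n t = t - 1 := by
  unfold vM; rw [if_neg (by omega), if_pos h2]

/-- The chord is anchored at `X_0`. -/
theorem vM_chord (n : ℕ) : vM n (2 * n + 2) = 0 := by
  unfold vM; rw [if_neg (by omega), if_neg (by omega), if_pos rfl]

/-- The whisker `d+1+r` is anchored at `X_r`. -/
theorem vM_wh (n t : ℕ) (h1 : 2 * n + 3 ≤ t) (h2 : t ≤ 4 * n + 3) : vM n t = t - (2 * n + 2) := by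
  unfold vM; rw [if_neg (by omega), if_neg (by omega), if_neg (by omega), if_neg (by omega)]

/-- `ℓ_{2d+2}` is anchored at `X_d`. -/
theorem vM_top (n : ℕ) : vM n (4 * n + 4) = 2 * n + 1 := by
  unfold vM; rw [if_neg (by omega), if_neg (by omega), if_neg (by omega), if_pos rfl]

/-- `EM` unfolded. -/
theorem EM_eq (n t j : ℕ) : EM n t j = yM n (vM n t) - yM n j + sM n t * ((j : ℤ) - (vM n t : ℕ)) := by
  unfold EM bM; ring

/-- The path identity `y_r - y_{r-1} = s_r` (`1 ≤ r ≤ d`). -/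
theorem yM_step (n r : ℕ) (h1 : 1 ≤ r) (h2 : r ≤ 2 * n + 1) : yM n r - yM n (r - 1) = sM n r := by
  rcases Nat.even_or_odd r with ⟨a, ha⟩ | ⟨a, ha⟩
  · -- r = 2a, 1 ≤ a ≤ n
    have ha' : r = 2 * a := by omega
    subst ha'
    have h3 : a ≤ n := by omega
    have h4 : 1 ≤ a := by omega
    obtain ⟨c, rfl⟩ : ∃ c, a = c + 1 := ⟨a - 1, by omega⟩
    have e1 : 2 * (c + 1) - 1 = 2 * c + 1 := by omega
    rw [e1, yM_even n (c + 1), yM_odd n c (by omega), sM_u n (c + 1) h3]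
    push_cast; ring
  · -- r = 2a+1
    subst ha
    by_cases hlast : a = n
    · subst hlast
      have e1 : 2 * a + 1 - 1 = 2 * a := by omega
      rw [e1, yM_last, yM_even a a, sM_last]; ring
    · have h3 : a + 1 ≤ n := by omega
      have e1 : 2 * a + 1 - 1 = 2 * a := by omega
      rw [e1, yM_odd n a h3, yM_even n a, sM_l n a h3]; ring

/-! ## Zero lemmas: the lines through `X_j` -/

/-- Edge `j` passes through `X_j`. -/
theorem EM_self (n j : ℕ) (hj : j ≤ 2 * n + 1) : EM n j j = 0 := by
  rw [EM_eq]
  rcases Nat.eq_zero_or_pos j with rfl | hpos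
  · rw [vM_zero]; simp
  · rw [vM_edge n j hpos hj]
    have := yM_step n j hpos hj
    have e : ((j : ℤ) - ((j - 1 : ℕ) : ℤ)) = 1 := by omega
    rw [e]; linarith

/-- Line `j+1` passes through `X_j` (an edge, or the chord when `j = d`). -/
theorem EM_succ (n j : ℕ) (hj : j ≤ 2 * n + 1) : EM n (j + 1) j = 0 := by
  rw [EM_eq]
  by_cases h : j + 1 ≤ 2 * n + 1
  · rw [vM_edge n (j + 1) (by omega) h]
    have e : j + 1 - 1 = j := by omega
    rw [e]; simp
  · have hj' : j = 2 * n + 1 := by omega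
    subst hj'
    have e : 2 * n + 1 + 1 = 2 * n + 2 := by ring
    rw [e, vM_chord, yM_zero, yM_last, sM_chord]; push_cast; ring

/-- Line `j+d+1` passes through `X_j` (the chord when `j = 0`, else the whisker at `X_j`). -/
theorem EM_far (n j : ℕ) (hj : j ≤ 2 * n + 1) : EM n (j + (2 * n + 2)) j = 0 := by
  rw [EM_eq]
  rcases Nat.eq_zero_or_pos j with rfl | hpos
  · rw [Nat.zero_add, vM_chord]; simp
  · rw [vM_wh n (j + (2 * n + 2)) (by omega) (by omega)]
    have e : j + (2 * n + 2) - (2 * n + 2) = j := by omega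
    rw [e]; simp

/-- Line `2d+2` passes through `X_d`. -/
theorem EM_top (n : ℕ) : EM n (4 * n + 4) (2 * n + 1) = 0 := by
  rw [EM_eq, vM_top]; simp

/-! ## Strict vertex lemmas (one-signed sums, written in closed form) -/

/-- Even edge `t = 2i` at a vertex `j ≤ t-2`: strictly above. -/
theorem EM_evenEdge (n i j : ℕ) (hi : i ≤ n) (hj : j + 2 ≤ 2 * i) : 0 < EM n (2 * i) j := by
  rw [EM_eq, vM_edge n (2 * i) (by omega) (by omega), sM_u n i hi]
  obtain ⟨c, rfl⟩ : ∃ c, i = c + 1 := ⟨i - 1, by omega⟩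
  have e1 : 2 * (c + 1) - 1 = 2 * c + 1 := by omega
  rw [e1, yM_odd n c (by omega)]
  rcases Nat.even_or_odd j with ⟨a, ha⟩ | ⟨a, ha⟩
  · have ha' : j = 2 * a := by omega
    subst ha'
    rw [yM_even n a]
    have hc : (a : ℤ) ≤ c := by exact_mod_cast (by omega : a ≤ c)
    push_cast
    nlinarith [hc]
  · subst ha
    rw [yM_odd n a (by omega)]
    have hc : (a : ℤ) + 1 ≤ c := by exact_mod_cast (by omega : a + 1 ≤ c)
    push_cast
    nlinarith [hc]

/-- Odd edge `t = 2i+1 ≤ d-2` at a vertex `j ≤ t-2`: strictly below. -/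
theorem EM_oddEdge (n i j : ℕ) (hi : i + 1 ≤ n) (hj : j + 2 ≤ 2 * i + 1) : EM n (2 * i + 1) j < 0 := by
  rw [EM_eq, vM_edge n (2 * i + 1) (by omega) (by omega), sM_l n i hi]
  have e1 : 2 * i + 1 - 1 = 2 * i := by omega
  rw [e1, yM_even n i]
  rcases Nat.even_or_odd j with ⟨a, ha⟩ | ⟨a, ha⟩
  · have ha' : j = 2 * a := by omega
    subst ha'
    rw [yM_even n a]
    have hc : (a : ℤ) + 1 ≤ i := by exact_mod_cast (by omega : a + 1 ≤ i)
    push_cast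
    nlinarith [hc]
  · subst ha
    rw [yM_odd n a (by omega)]
    have hc : (a : ℤ) + 1 ≤ i := by exact_mod_cast (by omega : a + 1 ≤ i)
    push_cast
    nlinarith [hc]

/-- The last edge `t = d` at a vertex `j ≤ d-2`: strictly below. -/
theorem EM_lastEdge (n j : ℕ) (hj : j + 2 ≤ 2 * n + 1) : EM n (2 * n + 1) j < 0 := by
  rw [EM_eq, vM_edge n (2 * n + 1) (by omega) le_rfl, sM_last]
  have e1 : 2 * n + 1 - 1 = 2 * n := by omega
  rw [e1, yM_even n n]
  rcases Nat.even_or_odd j with ⟨a, ha⟩ | ⟨a, ha⟩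
  · have ha' : j = 2 * a := by omega
    subst ha'
    rw [yM_even n a]
    have hc : (0 : ℤ) < (n : ℤ) - a := by
      have : (a : ℤ) + 1 ≤ n := by exact_mod_cast (by omega : a + 1 ≤ n)
      linarith
    have hn1 : (0 : ℤ) < (n : ℤ) + 1 := by positivity
    have h3 : (0 : ℤ) < 4 * (n : ℤ) + 2 := by positivity
    push_cast
    nlinarith [mul_pos (mul_pos hn1 hc) h3]
  · subst ha
    rw [yM_odd n a (by omega)]
    have hc : (0 : ℤ) ≤ (n : ℤ) - a - 1 := by
      have : (a : ℤ) + 1 ≤ n := by exact_mod_cast (by omega : a + 1 ≤ n)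
      linarith
    have h3 : (0 : ℤ) ≤ 4 * (n : ℤ) ^ 2 + 6 * n + 1 := by positivity
    push_cast
    nlinarith [mul_nonneg hc h3]

/-- The chord at an interior vertex `1 ≤ j ≤ d-1`: strictly above. -/
theorem EM_chordPos (n j : ℕ) (h1 : 1 ≤ j) (h2 : j ≤ 2 * n) : 0 < EM n (2 * n + 2) j := by
  rw [EM_eq, vM_chord, yM_zero, sM_chord]
  rcases Nat.even_or_odd j with ⟨a, ha⟩ | ⟨a, ha⟩
  · have ha' : j = 2 * a := by omega
    subst ha'
    rw [yM_even n a]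
    have hc : (1 : ℤ) ≤ a := by exact_mod_cast (by omega : 1 ≤ a)
    push_cast
    nlinarith [hc]
  · subst ha
    rw [yM_odd n a (by omega)]
    have ha0 : (0 : ℤ) ≤ a := by positivity
    have hn : (1 : ℤ) ≤ n := by exact_mod_cast (by omega : 1 ≤ n)
    push_cast
    nlinarith [ha0, hn]

/-- A lower whisker (through `X_{2i-1}`, slope `i-1`) at a later vertex `j`: strictly below. -/
theorem EM_lowerWh (n i j : ℕ) (hi : 1 ≤ i) (hi' : i ≤ n) (hj : 2 * i ≤ j) (hj' : j ≤ 2 * n + 1) :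
    EM n (2 * n + 1 + 2 * i) j < 0 := by
  rw [EM_eq, vM_wh n _ (by omega) (by omega), sM_lw n i hi hi']
  obtain ⟨c, rfl⟩ : ∃ c, i = c + 1 := ⟨i - 1, by omega⟩
  have e1 : 2 * n + 1 + 2 * (c + 1) - (2 * n + 2) = 2 * c + 1 := by omega
  rw [e1, yM_odd n c (by omega)]
  by_cases hlast : j = 2 * n + 1
  · subst hlast
    rw [yM_last]
    have hc : (c : ℤ) + 1 ≤ n := by exact_mod_cast (by omega : c + 1 ≤ n)
    have hc0 : (0 : ℤ) ≤ c := by positivity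
    push_cast
    nlinarith [hc, hc0]
  rcases Nat.even_or_odd j with ⟨a, ha⟩ | ⟨a, ha⟩
  · have ha' : j = 2 * a := by omega
    subst ha'
    rw [yM_even n a]
    have hc : (c : ℤ) + 1 ≤ a := by exact_mod_cast (by omega : c + 1 ≤ a)
    have hc' : (a : ℤ) ≤ n := by exact_mod_cast (by omega : a ≤ n)
    have hc0 : (0 : ℤ) ≤ c := by positivity
    push_cast
    nlinarith [hc, hc', hc0]
  · subst ha
    rw [yM_odd n a (by omega)]
    have hc : (c : ℤ) + 1 ≤ a := by exact_mod_cast (by omega : c + 1 ≤ a)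
    have hc' : (a : ℤ) + 1 ≤ n := by exact_mod_cast (by omega : a + 1 ≤ n)
    have hc0 : (0 : ℤ) ≤ c := by positivity
    push_cast
    nlinarith [hc, hc', hc0]

/-- An upper whisker (through `X_{2r}`, slope `(n+1)(2n+3)+r`) at a later vertex `j`: strictly above. -/
theorem EM_upperWh (n r j : ℕ) (hr : 1 ≤ r) (hr' : r ≤ n) (hj : 2 * r + 1 ≤ j) (hj' : j ≤ 2 * n + 1) :
    0 < EM n (2 * n + 2 + 2 * r) j := by
  rw [EM_eq, vM_wh n _ (by omega) (by omega), sM_uw n r hr hr']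
  have e1 : 2 * n + 2 + 2 * r - (2 * n + 2) = 2 * r := by omega
  rw [e1, yM_even n r]
  by_cases hlast : j = 2 * n + 1
  · subst hlast
    rw [yM_last]
    have hc : (0 : ℤ) ≤ (n : ℤ) - r := by
      have : (r : ℤ) ≤ n := by exact_mod_cast hr'
      linarith
    have hr0 : (1 : ℤ) ≤ r := by exact_mod_cast hr
    have hp : (0 : ℤ) ≤ 2 * ((n : ℤ) + 1) * (2 * n + 1) + 2 * r := by positivity
    push_cast
    nlinarith [mul_nonneg hc hp, hr0]
  rcases Nat.even_or_odd j with ⟨a, ha⟩ | ⟨a, ha⟩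
  · have ha' : j = 2 * a := by omega
    subst ha'
    rw [yM_even n a]
    have hc : (0 : ℤ) < (a : ℤ) - r := by
      have : (r : ℤ) + 1 ≤ a := by exact_mod_cast (by omega : r + 1 ≤ a)
      linarith
    have hp : (0 : ℤ) < ((n : ℤ) + 1) * (2 * n + 1) + r := by positivity
    push_cast
    nlinarith [mul_pos hc hp]
  · subst ha
    rw [yM_odd n a (by omega)]
    have hc : (0 : ℤ) ≤ (a : ℤ) - r := by
      have : (r : ℤ) ≤ a := by exact_mod_cast (by omega : r ≤ a)
      linarith
    have hn1 : (1 : ℤ) ≤ n := by exact_mod_cast (by omega : 1 ≤ n)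
    have hp : (0 : ℤ) ≤ 4 * (n : ℤ) ^ 2 + 6 * n + 1 + 2 * r := by positivity
    push_cast
    nlinarith [mul_nonneg hc hp, hn1]

/-! ## Crude slope bounds (used with the small offsets `±ε` at the three non-midpoint windows) -/

/-- All slopes are non-negative. -/
theorem sM_nonneg (n t : ℕ) : 0 ≤ sM n t := by
  unfold sM
  split_ifs with h1 h2 h3 h4 h5 h6 h7
  · have : t / 2 ≤ n := by omega
    have : ((t / 2 : ℕ) : ℤ) ≤ n := by exact_mod_cast this
    linarith
  · positivity
  · positivity
  · positivity
  · positivity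
  · positivity
  · positivity
  · have : 1 ≤ (t - (2 * n + 1)) / 2 := by omega
    have : (1 : ℤ) ≤ ((t - (2 * n + 1)) / 2 : ℕ) := by exact_mod_cast this
    linarith

/-- Crude upper bound on the slopes. -/
theorem sM_le (n t : ℕ) : sM n t ≤ (n + 1) * (2 * n + 3) + t := by
  unfold sM
  have hA : (0 : ℤ) ≤ (n + 1) * (2 * n + 3) := by positivity
  split_ifs with h1 h2 h3 h4 h5 h6 h7
  · have : (0 : ℤ) ≤ ((t / 2 : ℕ) : ℤ) := by positivity
    have ht : (t : ℤ) ≤ 2 * n := by exact_mod_cast h1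
    nlinarith
  · have : t / 2 ≤ t := Nat.div_le_self _ _
    have : ((t / 2 : ℕ) : ℤ) ≤ t := by exact_mod_cast this
    have ht : (t : ℤ) ≤ 2 * n := by exact_mod_cast h1
    nlinarith
  · nlinarith
  · nlinarith
  · nlinarith
  · nlinarith
  · have : (t - (2 * n + 2)) / 2 ≤ t := le_trans (Nat.div_le_self _ _) (Nat.sub_le _ _)
    have : (((t - (2 * n + 2)) / 2 : ℕ) : ℤ) ≤ t := by exact_mod_cast this
    push_cast; nlinarith
  · have : (t - (2 * n + 1)) / 2 ≤ t := le_trans (Nat.div_le_self _ _) (Nat.sub_le _ _)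
    have : (((t - (2 * n + 1)) / 2 : ℕ) : ℤ) ≤ t := by exact_mod_cast this
    nlinarith

end Summit.ValiantsHypothesis.ValiantsHypothesis.Theorems.KPlusLogSqLawStepSharpFamily
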